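import Literature.AlgebraicGeometry.Frobenioids.ArchimedeanSlim
import Literature.AlgebraicGeometry.Frobenioids.ArchimedeanSlimAngular
import Literature.AlgebraicGeometry.Frobenioids.ArchimedeanTheoremsInstances
import HarnessLib

/-!
# Frobenioids II, Theorem 3.6 (x) at the data of Example 3.3: the instance slot `Thm36x_CA` of
# `ArchimedeanTheoremsInstances.lean`, assembled over any base (residue: the realification interface)

Mochizuki, *The geometry of Frobenioids II: poly-Frobenioids*, Kyushu J. Math. **62** (2008)
401–460, §3, Theorem 3.6 (x), author's kurims text p. 38 [cite: MochizukiFrdII2008, Thm 3.6 (x) p.38]: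

> "(x) If `D` is slim, and `Λ ∈ {ℤ, ℝ}`, then `F` is also slim."

for `F ∈ {C^Λ, A}`. The printed claim at the data of Example 3.3 over a base `π : D → D₀` is the named
`Prop` `ArchFrd.Thm36x_CA π pf rlf` of `ArchimedeanTheoremsInstances.lean` (seat abc-iut-L1-t9):
`(∀ Λ, Thm36x Λ D (C^Λ).cat) ∧ Thm36x ℤ D A`. State of its conjuncts in the tree:
* `Λ = ℤ`, `F = C = C^ℤ`: PROVED, `ArchFrd.Slim.thm36x_C` (`ArchimedeanSlim.lean`, seat abc-iut-L6-d7);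
* `F = A`: PROVED, `ArchFrd.Slim.thm36x_A` (`ArchimedeanSlimAngular.lean`, seat abc-iut-L6-d7);
* `Λ = ℚ`: vacuous as printed ("`Λ ∈ {ℤ, ℝ}`"), `ArchFrd.Slim.thm36x_Q`;
* `Λ = ℝ`, `F = C^ℝ := C^rlf`: the realification of `C` is NOT a constructed category in the tree — it
  is the INTERFACE datum `rlf : LambdaCompletion π` (`AngularFrobenioidsRelative.lean`; TODO-merge
  abc-iut-L1-t5 / [FrdI] Prop. 5.3 realification), whose underlying category `rlf.cat` is arbitrary, so
  "`D` slim ⇒ `rlf.cat` slim" is not a statement about the paper's object and cannot be proved (nor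
  should it be assumed) at this generality.

THIS FILE (proof-only; plan/L1 row M5, node FrdII:Thm3.6(x)) records the assembly: the `Λ = ℤ` and
`Λ = ℚ` instances of the `C^Λ`-conjunct at the instance data (`thm36x_CZ`, `thm36x_CQ`), and
`Thm36x_CA` in full GIVEN the `Λ = ℝ` clause for the realification datum (`thm36x_CA_of_rlf`) — the
exact residue, to be discharged by whoever constructs `C^rlf` as a `LambdaCompletion` (then: the model
Frobenioid of `Φ^rlf` over `D`, slim by the argument of `ArchimedeanSlim.lean` with `ℝ`-divisors).
HONEST FRAMING: a 2008 refereed paper; nothing here bears on [IUTchIII] Cor. 3.12; no statement is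
strengthened or weakened; typed ≠ proved — the `Λ = ℝ` clause stays an explicit hypothesis.
-/

namespace Literature.AlgebraicGeometry.Frobenioids

open CategoryTheory

universe v u

namespace ArchFrd

variable {D : Type u} [Category.{v} D] (π : D ⥤ D0) (pf rlf : LambdaCompletion π)

/-- **Theorem 3.6 (x), `Λ = ℤ`, at the instance data** (`C^ℤ = C`): `D` slim ⇒ `C` slim — PROVED
(`ArchFrd.Slim.thm36x_C`). [cite: MochizukiFrdII2008, Thm 3.6 (x) p.38] -/
theorem thm36x_CZ : Thm36x MonoidType.Z D (archFrobenioid π pf rlf .Z).cat :=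
  Slim.thm36x_C π

/-- **Theorem 3.6 (x), `Λ = ℚ`, at the instance data**: vacuous as printed ("`Λ ∈ {ℤ, ℝ}`").
[cite: MochizukiFrdII2008, Thm 3.6 (x) p.38] -/
theorem thm36x_CQ : Thm36x MonoidType.Q D (archFrobenioid π pf rlf .Q).cat :=
  Slim.thm36x_Q (archFrobenioid π pf rlf .Q).cat

/-- **Theorem 3.6 (x) at the data of Example 3.3** — the slot `ArchFrd.Thm36x_CA` GIVEN its `Λ = ℝ`
clause for the realification datum `rlf` (interface; the only residue): the `C^ℤ`, `C^ℚ` and `A` clauses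
are the tree's proofs. [cite: MochizukiFrdII2008, Thm 3.6 (x) p.38] -/
theorem thm36x_CA_of_rlf (hrlf : Thm36x MonoidType.R D rlf.cat) : Thm36x_CA π pf rlf := by
  refine ⟨fun Λ => ?_, Slim.thm36x_A π⟩
  cases Λ with
  | Z => exact thm36x_CZ π pf rlf
  | Q => exact thm36x_CQ π pf rlf
  | R => exact hrlf

/-- Conversely the slot contains the `Λ = ℝ` clause: `Thm36x_CA` is EQUIVALENT to "`D` slim ⇒ `C^rlf`
slim" over the tree's proofs of the other clauses. [cite: MochizukiFrdII2008, Thm 3.6 (x) p.38] -/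
theorem thm36x_CA_iff_rlf : Thm36x_CA π pf rlf ↔ Thm36x MonoidType.R D rlf.cat :=
  ⟨fun h => h.1 .R, thm36x_CA_of_rlf π pf rlf⟩

end ArchFrd

end Literature.AlgebraicGeometry.Frobenioids
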